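import Summits.QuantumFields.QCD.Theorems.GaussianLinkFramesFrameFMClosurePlacementSidesAux6

/-!
# Crux `GaussianLinkFrames.FrameFMClosure` (stmt-QuantumFields-17375), line `pad-the-fibre`, stub
`stub_placementSides` — helper 7: blocks for the ANTIPODAL configurations of the thinnest box complement

For `r = S - 1` the side `A = (ebox S z r)ᶜ` is the union of the four antipodal hyperplanes `{y_j = q_j}`,
`q_j = z_j + S`, and the layered flip of helper 6 is unavailable exactly when every coordinate of `a` or of `b` is
antipodal.  These configurations are paired by the DEFECT-TRIPLE FLIP: in coordinate `j` fix a centre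
`t_j ∈ {q_j - 1, q_j, q_j + 1}` and pair `ZMod N ∖ {t_j - 1, t_j, t_j + 1}` (an even arc) by dominoes from
`p_j = t_j + 2`; a site with some coordinate off its defect triple ("far") is flipped in the first such coordinate —
it keeps its antipodal coordinates, so it stays in `A` — and the sites with all coordinates in their triples ("core")
are treated by hand (helpers 8–9).  This file gives the one-dimensional data (`tstar_coord_data`: for every residue a
pad position whose refitted block meets the even arc in dominoes, with its trace on the triple made explicit) and
the block of one point with its far-flip stability (`tstar_block`).

References: elementary [folklore]; the pad recipe is the line card of `pad-the-fibre`.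
-/

noncomputable section

open scoped BigOperators
open Literature.MathematicalPhysics.QuantumFieldTheory Literature.MathematicalPhysics.QuantumLattice
  Literature.Probability.LatticeModels
open Summit.QuantumFields.QCD.Theorems.VonMisesCircles Summit.QuantumFields.QCD.Theorems.PadTheFibre

namespace Summit.QuantumFields.QCD.Theorems.PadTheFibreTwoStar

/-! ## §1 One coordinate: pads adapted to a defect triple -/

/-- **Pad data in one coordinate for a defect triple.**  Offsets are read from `p` (`= t + 2` for the triple
`{t-1, t, t+1}`, which occupies the offsets `N-3, N-2, N-1`; the even arc is `[0, N-4]`).  For every residue `c₀`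
(offset `d`) there are a pad base `B`, a frozen flag `fz` with layer code `cv ∈ {-2, 1}`, a window `[k₁, k₂] ⊆ [0, N-4]`
(`k₁` even, `k₂` odd, possibly empty) and a trace `[j₁, j₂] ⊆ [N-3, N-1]` (possibly empty) such that `c₀` is in the
core away from the frozen layer, a residue of the arc lies in the refitted block iff its offset is in the window, the
window lies in the block, and the block meets the triple exactly in the trace; the trace is listed by cases on `d`
(`mode3` selects the narrower block at `d ∈ {0, N-4}`, `hi` the frozen side at `d = N-2`). [folklore] -/
theorem tstar_coord_data {N : ℕ} [NeZero N] (hN : 9 ≤ N) (hNo : Odd N) (p c₀ : ZMod N) (mode3 hi : Bool) :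
    ∃ (B : ZMod N) (fz : Bool) (cv : ℤ) (k₁ k₂ j₁ j₂ : ℕ), (cv = -2 ∨ cv = 1) ∧
      ((c₀ - B).val = 1 ∨ (c₀ - B).val = 2) ∧
      (fz = true → (cv = -2 → (c₀ - B).val = 2) ∧ (cv = 1 → (c₀ - B).val = 1)) ∧
      Even k₁ ∧ Odd k₂ ∧ k₂ ≤ N - 4 ∧ N - 3 ≤ j₁ ∧ j₂ ≤ N - 1 ∧
      (∀ u : ZMod N,
        (((u - B).val ≤ 3 ∧ (fz = true → ((u - B).val : ℤ) ≠ cv + 2)) ∧ (u - p).val ≤ N - 4 →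
            k₁ ≤ (u - p).val ∧ (u - p).val ≤ k₂) ∧
        (k₁ ≤ (u - p).val ∧ (u - p).val ≤ k₂ → (u - B).val ≤ 3 ∧ (fz = true → ((u - B).val : ℤ) ≠ cv + 2)) ∧
        (((u - B).val ≤ 3 ∧ (fz = true → ((u - B).val : ℤ) ≠ cv + 2)) ∧ N - 3 ≤ (u - p).val ↔
            j₁ ≤ (u - p).val ∧ (u - p).val ≤ j₂)) ∧
      ((c₀ - p).val = N - 2 → j₁ = N - 3 ∧ j₂ = N - 1) ∧
      ((c₀ - p).val = N - 1 → j₁ = N - 2 ∧ j₂ = N - 1) ∧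
      ((c₀ - p).val = 0 → (mode3 = true → j₁ = N - 1 ∧ j₂ = N - 1) ∧ (mode3 = false → j₁ = N - 2 ∧ j₂ = N - 1)) ∧
      ((c₀ - p).val = N - 4 → (mode3 = true → j₁ = N - 3 ∧ j₂ = N - 3) ∧ (mode3 = false → j₁ = N - 3 ∧ j₂ = N - 2)) ∧
      ((c₀ - p).val = N - 3 → j₁ = N - 3 ∧ j₂ = N - 2) ∧
      (1 ≤ (c₀ - p).val ∧ (c₀ - p).val ≤ N - 5 → j₂ < j₁) ∧
      (B = c₀ - 2 ∨ B = c₀ - 1) ∧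
      (1 ≤ (c₀ - p).val ∧ (c₀ - p).val ≤ N - 5 → (Even (c₀ - p).val → B = c₀ - 2) ∧ (Odd (c₀ - p).val → B = c₀ - 1)) ∧
      ((c₀ - p).val = 0 ∨ (c₀ - p).val = N - 3 → B = c₀ - 2) ∧
      ((c₀ - p).val = N - 1 ∨ (c₀ - p).val = N - 4 → B = c₀ - 1) ∧
      ((c₀ - p).val = N - 2 → fz = true ∧ k₁ = 2 ∧ k₂ = 1 ∧ (hi = false → B = c₀ - 2 ∧ cv = -2) ∧
        (hi = true → B = c₀ - 1 ∧ cv = 1)) ∧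
      ((c₀ - p).val = N - 3 → fz = false ∧ k₁ = N - 5 ∧ k₂ = N - 4) ∧
      ((c₀ - p).val = N - 1 → fz = false ∧ k₁ = 0 ∧ k₂ = 1) := by
  set d := (c₀ - p).val with hd
  have hdN : d < N := ZMod.val_lt _
  obtain ⟨S, hS⟩ := hNo
  have hc2 : (c₀ - (c₀ - 2)).val = 2 := by
    rw [show c₀ - (c₀ - 2) = ((2 : ℕ) : ZMod N) by push_cast; ring, ZMod.val_cast_of_lt (by omega)]
  have hc1 : (c₀ - (c₀ - 1)).val = 1 := by
    rw [show c₀ - (c₀ - 1) = ((1 : ℕ) : ZMod N) by push_cast; ring, ZMod.val_cast_of_lt (by omega)]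
  have hB2 : 2 ≤ d → ∀ u : ZMod N, (u - (c₀ - 2)).val =
      if d - 2 ≤ (u - p).val then (u - p).val - (d - 2) else (u - p).val + N - (d - 2) := by
    intro h2 u
    refine val_sub_transfer p (c₀ - 2) (d - 2) ?_ u
    rw [show c₀ - 2 - p = (c₀ - p) - ((2 : ℕ) : ZMod N) by push_cast; ring]
    exact val_sub_natCast_of_le _ 2 h2
  have hB1 : 1 ≤ d → ∀ u : ZMod N, (u - (c₀ - 1)).val =
      if d - 1 ≤ (u - p).val then (u - p).val - (d - 1) else (u - p).val + N - (d - 1) := by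
    intro h1 u
    refine val_sub_transfer p (c₀ - 1) (d - 1) ?_ u
    rw [show c₀ - 1 - p = (c₀ - p) - ((1 : ℕ) : ZMod N) by push_cast; ring]
    exact val_sub_natCast_of_le _ 1 h1
  have h2N : ((2 : ℕ) : ZMod N) ≠ 0 := by
    intro h; rw [ZMod.natCast_eq_zero_iff] at h; have := Nat.le_of_dvd (by norm_num) h; omega
  have hB2' : d = 0 → ∀ u : ZMod N, (u - (c₀ - 2)).val =
      if N - 2 ≤ (u - p).val then (u - p).val - (N - 2) else (u - p).val + N - (N - 2) := by
    intro h0 u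
    have hcp : c₀ = p := sub_eq_zero.1 ((ZMod.val_eq_zero _).1 (by rw [← hd]; exact h0))
    refine val_sub_transfer p (c₀ - 2) (N - 2) ?_ u
    rw [hcp, show p - 2 - p = -((2 : ℕ) : ZMod N) by push_cast; ring, ZMod.neg_val, if_neg h2N,
      ZMod.val_cast_of_lt (by omega)]
  -- the case list
  by_cases hA : d = N - 2
  · -- the centre of the triple: interior = the triple, one far side frozen
    cases hi
    · refine ⟨c₀ - 2, true, -2, 2, 1, N - 3, N - 1, Or.inl rfl, Or.inr hc2, fun _ => ⟨fun _ => hc2, fun h => ?_⟩,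
        ⟨1, rfl⟩, ⟨0, rfl⟩, by omega, le_rfl, le_rfl, fun u => ?_, fun _ => ⟨rfl, rfl⟩, fun h => by omega,
        fun h => by omega, fun h => by omega, fun h => by omega, fun h => by omega, Or.inl rfl, fun h => by omega,
        fun h => by omega, fun h => by omega, fun _ => ⟨rfl, rfl, rfl, fun _ => ⟨rfl, rfl⟩, fun h => by simp at h⟩,
        fun h => by omega, fun h => by omega⟩
      · norm_num at h
      · have hul : (u - p).val < N := ZMod.val_lt _
        have ht := hB2 (by omega) u
        simp only [forall_const]
        refine ⟨?_, fun h => by omega, ?_⟩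
        · rintro ⟨⟨hs, hs0⟩, htl⟩; rw [ht] at hs hs0; split_ifs at hs hs0 with h
          · omega
          · exfalso; have : (u - p).val + N - (d - 2) = 0 := by omega
            exact hs0 (by rw [this]; norm_num)
        · constructor
          · rintro ⟨⟨hs, hs0⟩, htl⟩; rw [ht] at hs hs0; split_ifs at hs hs0 with h
            · constructor <;> omega
            · exfalso; have : (u - p).val + N - (d - 2) = 0 := by omega
              exact hs0 (by rw [this]; norm_num)
          · rintro ⟨h1, h3⟩; rw [ht, if_pos (by omega)]
            exact ⟨⟨by omega, fun h => by omega⟩, by omega⟩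
    · refine ⟨c₀ - 1, true, 1, 2, 1, N - 3, N - 1, Or.inr rfl, Or.inl hc1, fun _ => ⟨fun h => ?_, fun _ => hc1⟩,
        ⟨1, rfl⟩, ⟨0, rfl⟩, by omega, le_rfl, le_rfl, fun u => ?_, fun _ => ⟨rfl, rfl⟩, fun h => by omega,
        fun h => by omega, fun h => by omega, fun h => by omega, fun h => by omega, Or.inr rfl, fun h => by omega,
        fun h => by omega, fun h => by omega, fun _ => ⟨rfl, rfl, rfl, fun h => by simp at h, fun _ => ⟨rfl, rfl⟩⟩,
        fun h => by omega, fun h => by omega⟩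
      · norm_num at h
      · have hul : (u - p).val < N := ZMod.val_lt _
        have ht := hB1 (by omega) u
        simp only [forall_const]
        refine ⟨?_, fun h => by omega, ?_⟩
        · rintro ⟨⟨hs, hs0⟩, htl⟩; rw [ht] at hs hs0; split_ifs at hs hs0 with h
          · exfalso; have : (u - p).val - (d - 1) = 3 := by omega
            exact hs0 (by rw [this]; norm_num)
          · omega
        · constructor
          · rintro ⟨⟨hs, hs0⟩, htl⟩; rw [ht] at hs hs0; split_ifs at hs hs0 with h
            · constructor
              · omega
              · by_contra h'
                have : (u - p).val - (d - 1) = 3 := by omega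
                exact hs0 (by rw [this]; norm_num)
            · omega
          · rintro ⟨h1, h3⟩; rw [ht, if_pos (by omega)]
            exact ⟨⟨by omega, fun h => by omega⟩, by omega⟩
  by_cases hB : d = N - 1
  · -- just above the triple's... `c₀ = t + 1`: pad `{t, …, t+3}`
    refine ⟨c₀ - 1, false, -2, 0, 1, N - 2, N - 1, Or.inl rfl, Or.inl hc1, fun h => by simp at h, ⟨0, rfl⟩,
      ⟨0, rfl⟩, by omega, by omega, le_rfl, fun u => ?_, fun h => by omega, fun _ => ⟨rfl, rfl⟩, fun h => by omega,
      fun h => by omega, fun h => by omega, fun h => by omega, Or.inr rfl, fun h => by omega, fun h => by omega,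
      fun _ => rfl, fun h => by omega, fun h => by omega, fun _ => ⟨rfl, rfl, rfl⟩⟩
    have hul : (u - p).val < N := ZMod.val_lt _
    have ht := hB1 (by omega) u
    simp only [Bool.false_eq_true, false_implies, and_true]
    refine ⟨?_, fun h => ?_, ?_⟩
    · rintro ⟨hs, htl⟩; rw [ht] at hs; split_ifs at hs with h <;> omega
    · rw [ht]; split_ifs with h <;> omega
    · rw [ht]; constructor
      · rintro ⟨hs, htl⟩; split_ifs at hs with h <;> constructor <;> omega
      · rintro ⟨h1, h3⟩; rw [if_pos (by omega)]; omega
  by_cases hC : d = 0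
  · cases mode3
    · -- `c₀ = t + 2`, wide: pad `{t, …, t+3}`
      refine ⟨c₀ - 2, false, -2, 0, 1, N - 2, N - 1, Or.inl rfl, Or.inr hc2, fun h => by simp at h, ⟨0, rfl⟩,
        ⟨0, rfl⟩, by omega, by omega, le_rfl, fun u => ?_, fun h => by omega, fun h => by omega,
        fun _ => ⟨fun h => by simp at h, fun _ => ⟨rfl, rfl⟩⟩, fun h => by omega, fun h => by omega, fun h => by omega,
        Or.inl rfl, fun h => by omega, fun _ => rfl, fun h => by omega, fun h => by omega, fun h => by omega,
        fun h => by omega⟩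
      have hul : (u - p).val < N := ZMod.val_lt _
      have ht := hB2' hC u
      simp only [Bool.false_eq_true, false_implies, and_true]
      refine ⟨?_, fun h => ?_, ?_⟩
      · rintro ⟨hs, htl⟩; rw [ht] at hs; split_ifs at hs with h <;> omega
      · rw [ht]; split_ifs with h <;> omega
      · rw [ht]; constructor
        · rintro ⟨hs, htl⟩; split_ifs at hs with h <;> constructor <;> omega
        · rintro ⟨h1, h3⟩; rw [if_pos (by omega)]; omega
    · -- `c₀ = t + 2`, narrow: pad `{t, …, t+3}` with `t` frozen
      refine ⟨c₀ - 2, true, -2, 0, 1, N - 1, N - 1, Or.inl rfl, Or.inr hc2, fun _ => ⟨fun _ => hc2, fun h => ?_⟩,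
        ⟨0, rfl⟩, ⟨0, rfl⟩, by omega, by omega, le_rfl, fun u => ?_, fun h => by omega, fun h => by omega,
        fun _ => ⟨fun _ => ⟨rfl, rfl⟩, fun h => by simp at h⟩, fun h => by omega, fun h => by omega, fun h => by omega,
        Or.inl rfl, fun h => by omega, fun _ => rfl, fun h => by omega, fun h => by omega, fun h => by omega,
        fun h => by omega⟩
      · norm_num at h
      · have hul : (u - p).val < N := ZMod.val_lt _
        have ht := hB2' hC u
        simp only [forall_const]
        refine ⟨?_, fun h => ?_, ?_⟩
        · rintro ⟨⟨hs, -⟩, htl⟩; rw [ht] at hs; split_ifs at hs with h <;> omega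
        · rw [ht, if_neg (by omega)]; exact ⟨by omega, fun h' => by push_cast at h'; omega⟩
        · rw [ht]; constructor
          · rintro ⟨⟨hs, hs0⟩, htl⟩; split_ifs at hs hs0 with h
            · constructor
              · by_contra h'
                have : (u - p).val - (N - 2) = 0 := by omega
                exact hs0 (by rw [this]; norm_num)
              · omega
            · constructor <;> omega
          · rintro ⟨h1, h3⟩; rw [if_pos (by omega)]
            exact ⟨⟨by omega, fun h => by omega⟩, by omega⟩
  by_cases hD : d = N - 4
  · cases mode3
    · -- `c₀ = t - 2`, wide: pad `{t-3, …, t}`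
      refine ⟨c₀ - 1, false, -2, N - 5, N - 4, N - 3, N - 2, Or.inl rfl, Or.inl hc1, fun h => by simp at h,
        ⟨S - 2, by omega⟩, ⟨S - 2, by omega⟩, le_rfl, le_rfl, by omega, fun u => ?_, fun h => by omega,
        fun h => by omega, fun h => by omega, fun _ => ⟨fun h => by simp at h, fun _ => ⟨rfl, rfl⟩⟩,
        fun h => by omega, fun h => by omega, Or.inr rfl, fun h => by omega, fun h => by omega, fun _ => rfl,
        fun h => by omega, fun h => by omega, fun h => by omega⟩
      have hul : (u - p).val < N := ZMod.val_lt _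
      have ht := hB1 (by omega) u
      simp only [Bool.false_eq_true, false_implies, and_true]
      refine ⟨?_, fun h => ?_, ?_⟩
      · rintro ⟨hs, htl⟩; rw [ht] at hs; split_ifs at hs with h <;> omega
      · rw [ht]; split_ifs with h <;> omega
      · rw [ht]; constructor
        · rintro ⟨hs, htl⟩; split_ifs at hs with h <;> constructor <;> omega
        · rintro ⟨h1, h3⟩; rw [if_pos (by omega)]; omega
    · -- `c₀ = t - 2`, narrow: pad `{t-3, …, t}` with `t` frozen
      refine ⟨c₀ - 1, true, 1, N - 5, N - 4, N - 3, N - 3, Or.inr rfl, Or.inl hc1, fun _ => ⟨fun h => ?_, fun _ => hc1⟩,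
        ⟨S - 2, by omega⟩, ⟨S - 2, by omega⟩, le_rfl, le_rfl, by omega, fun u => ?_, fun h => by omega,
        fun h => by omega, fun h => by omega, fun _ => ⟨fun _ => ⟨rfl, rfl⟩, fun h => by simp at h⟩,
        fun h => by omega, fun h => by omega, Or.inr rfl, fun h => by omega, fun h => by omega, fun _ => rfl,
        fun h => by omega, fun h => by omega, fun h => by omega⟩
      · norm_num at h
      · have hul : (u - p).val < N := ZMod.val_lt _
        have ht := hB1 (by omega) u
        simp only [forall_const]
        refine ⟨?_, fun h => ?_, ?_⟩
        · rintro ⟨⟨hs, -⟩, htl⟩; rw [ht] at hs; split_ifs at hs with h <;> omega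
        · rw [ht, if_pos (by omega)]; exact ⟨by omega, fun h' => by push_cast at h'; omega⟩
        · rw [ht]; constructor
          · rintro ⟨⟨hs, hs0⟩, htl⟩; split_ifs at hs hs0 with h
            · constructor
              · omega
              · by_contra h'
                have : (u - p).val - (d - 1) = 3 := by omega
                exact hs0 (by rw [this]; norm_num)
            · omega
          · rintro ⟨h1, h3⟩; rw [if_pos (by omega)]
            exact ⟨⟨by omega, fun h => by omega⟩, by omega⟩
  by_cases hE : d = N - 3
  · -- `c₀ = t - 1`: pad `{t-3, …, t}`
    refine ⟨c₀ - 2, false, -2, N - 5, N - 4, N - 3, N - 2, Or.inl rfl, Or.inr hc2, fun h => by simp at h,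
      ⟨S - 2, by omega⟩, ⟨S - 2, by omega⟩, le_rfl, le_rfl, by omega, fun u => ?_, fun h => by omega,
      fun h => by omega, fun h => by omega, fun h => by omega, fun _ => ⟨rfl, rfl⟩, fun h => by omega, Or.inl rfl,
      fun h => by omega, fun _ => rfl, fun h => by omega, fun h => by omega, fun _ => ⟨rfl, rfl, rfl⟩, fun h => by omega⟩
    have hul : (u - p).val < N := ZMod.val_lt _
    have ht := hB2 (by omega) u
    simp only [Bool.false_eq_true, false_implies, and_true]
    refine ⟨?_, fun h => ?_, ?_⟩
    · rintro ⟨hs, htl⟩; rw [ht] at hs; split_ifs at hs with h <;> omega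
    · rw [ht]; split_ifs with h <;> omega
    · rw [ht]; constructor
      · rintro ⟨hs, htl⟩; split_ifs at hs with h <;> constructor <;> omega
      · rintro ⟨h1, h3⟩; rw [if_pos (by omega)]; omega
  · -- the generic far residue `1 ≤ d ≤ N - 5`: an aligned `4`-range inside the arc, empty trace
    have hdr : 1 ≤ d ∧ d ≤ N - 5 := by omega
    rcases Nat.even_or_odd d with ⟨k, hk⟩ | ⟨k, hk⟩
    · refine ⟨c₀ - 2, false, -2, d - 2, d + 1, N, N - 1, Or.inl rfl, Or.inr hc2, fun h => by simp at h,
        ⟨k - 1, by omega⟩, ⟨k, by omega⟩, by omega, by omega, le_rfl, fun u => ?_, fun h => by omega,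
        fun h => by omega, fun h => by omega, fun h => by omega, fun h => by omega, fun _ => by omega, Or.inl rfl,
        fun _ => ⟨fun _ => rfl, fun h => by obtain ⟨k', hk'⟩ := h; omega⟩, fun h => by omega, fun h => by omega,
        fun h => by omega, fun h => by omega, fun h => by omega⟩
      have hul : (u - p).val < N := ZMod.val_lt _
      have ht := hB2 (by omega) u
      simp only [Bool.false_eq_true, false_implies, and_true]
      refine ⟨?_, fun h => ?_, ?_⟩
      · rintro ⟨hs, htl⟩; rw [ht] at hs; split_ifs at hs with h <;> omega
      · rw [ht]; split_ifs with h <;> omega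
      · rw [ht]; constructor
        · rintro ⟨hs, htl⟩; split_ifs at hs with h <;> omega
        · rintro ⟨h1, h3⟩; omega
    · refine ⟨c₀ - 1, false, -2, d - 1, d + 2, N, N - 1, Or.inl rfl, Or.inl hc1, fun h => by simp at h,
        ⟨k, by omega⟩, ⟨k + 1, by omega⟩, by omega, by omega, le_rfl, fun u => ?_, fun h => by omega,
        fun h => by omega, fun h => by omega, fun h => by omega, fun h => by omega, fun _ => by omega, Or.inr rfl,
        fun _ => ⟨fun h => by obtain ⟨k', hk'⟩ := h; omega, fun _ => rfl⟩, fun h => by omega, fun h => by omega,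
        fun h => by omega, fun h => by omega, fun h => by omega⟩
      have hul : (u - p).val < N := ZMod.val_lt _
      have ht := hB1 (by omega) u
      simp only [Bool.false_eq_true, false_implies, and_true]
      refine ⟨?_, fun h => ?_, ?_⟩
      · rintro ⟨hs, htl⟩; rw [ht] at hs; split_ifs at hs with h <;> omega
      · rw [ht]; split_ifs with h <;> omega
      · rw [ht]; constructor
        · rintro ⟨hs, htl⟩; split_ifs at hs with h <;> omega
        · rintro ⟨h1, h3⟩; omega

/-! ## §2 The block of one point and the far flip -/

/-- **The block of a point adapted to defect triples** (`2 ≤ S`).  Given per-coordinate pad data as produced by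
`tstar_coord_data` (bases `B`, frozen flags `fz` with codes `cv`, windows `[k₁, k₂]` and traces `[j₁, j₂]` from the
bases `p`), the pad centred at `B + 2` with the flagged far layers frozen holds `c` in its core with its whole star
in the interior, and an arbitrary site lies in the interior iff each coordinate offset lies in the window or in the
trace. [folklore] -/
theorem tstar_block {S : ℕ} (hS : 2 ≤ S) (p B : Fin 4 → ZMod (2 * S + 1)) (fz : Fin 4 → Bool) (cv : Fin 4 → ℤ)
    (k₁ k₂ j₁ j₂ : Fin 4 → ℕ) (c : TorusSite 4 (2 * S + 1)) (hcv : ∀ j, cv j = -2 ∨ cv j = 1)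
    (hcore : ∀ j, (c j - B j).val = 1 ∨ (c j - B j).val = 2)
    (hfar : ∀ j, fz j = true → (cv j = -2 → (c j - B j).val = 2) ∧ (cv j = 1 → (c j - B j).val = 1))
    (hwin : ∀ j (u : ZMod (2 * S + 1)),
      (((u - B j).val ≤ 3 ∧ (fz j = true → ((u - B j).val : ℤ) ≠ cv j + 2)) ∧ (u - p j).val ≤ 2 * S + 1 - 4 →
          k₁ j ≤ (u - p j).val ∧ (u - p j).val ≤ k₂ j) ∧
      (k₁ j ≤ (u - p j).val ∧ (u - p j).val ≤ k₂ j →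
          (u - B j).val ≤ 3 ∧ (fz j = true → ((u - B j).val : ℤ) ≠ cv j + 2)) ∧
      (((u - B j).val ≤ 3 ∧ (fz j = true → ((u - B j).val : ℤ) ≠ cv j + 2)) ∧ 2 * S + 1 - 3 ≤ (u - p j).val ↔
          j₁ j ≤ (u - p j).val ∧ (u - p j).val ≤ j₂ j)) :
    let x' : TorusSite 4 (2 * S + 1) := fun j => B j + 2
    let M : Finset (Fin 4) := Finset.univ.filter fun j => fz j = true
    (∀ μ ∈ M, cv μ = -2 ∨ cv μ = 1) ∧ c ∈ ebox S x' 0 ∧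
      (c ∈ ebox S x' 1 \ padFrozen S x' M cv ∧ ∀ μ : Fin 4, c + Pi.single μ 1 ∈ ebox S x' 1 \ padFrozen S x' M cv ∧
        c - Pi.single μ 1 ∈ ebox S x' 1 \ padFrozen S x' M cv) ∧
      ∀ y : TorusSite 4 (2 * S + 1), y ∈ ebox S x' 1 \ padFrozen S x' M cv ↔
        ∀ j, (k₁ j ≤ (y j - p j).val ∧ (y j - p j).val ≤ k₂ j) ∨ (j₁ j ≤ (y j - p j).val ∧ (y j - p j).val ≤ j₂ j) := by
  haveI : NeZero (2 * S + 1) := ⟨by omega⟩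
  intro x' M
  have hoff : ∀ (y : TorusSite 4 (2 * S + 1)) j, y j - x' j + 2 = y j - B j := fun y j => by
    show y j - (B j + 2) + 2 = y j - B j; ring
  have hMj : ∀ j, j ∈ M ↔ fz j = true := fun j => by simp [M]
  have hP : ∀ y : TorusSite 4 (2 * S + 1), y ∈ ebox S x' 1 \ padFrozen S x' M cv ↔
      ∀ j, (y j - B j).val ≤ 3 ∧ (fz j = true → ((y j - B j).val : ℤ) ≠ cv j + 2) := by
    intro y
    rw [mem_interior_iff_val hS x' y M cv]
    simp only [hoff, hMj]
    exact ⟨fun h j => ⟨h.1 j, fun hj => h.2 j hj⟩, fun h => ⟨fun j => (h j).1, fun j hj => (h j).2 hj⟩⟩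
  refine ⟨fun μ _ => hcv μ, ?_, ?_, fun y => ?_⟩
  · rw [mem_core_iff_val (by omega) x' c]
    intro j
    have h1 : 1 ≤ (c j - B j).val := by rcases hcore j with h | h <;> omega
    rw [show c j - x' j + 1 = (c j - B j) - 1 by rw [← hoff]; ring, val_sub_one_of_le _ h1]
    rcases hcore j with h | h <;> omega
  · exact star_subset_interior hS x' c M cv (fun μ _ => hcv μ) (fun j => by rw [hoff]; exact hcore j)
      (fun μ hμ => by rw [hoff]; exact hfar μ ((hMj μ).1 hμ))
  · rw [hP]
    refine forall_congr' fun j => ?_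
    obtain ⟨h1, h2, h3⟩ := hwin j (y j)
    have hul : (y j - p j).val < 2 * S + 1 := ZMod.val_lt _
    constructor
    · intro hI
      rcases le_or_gt ((y j - p j).val) (2 * S + 1 - 4) with hle | hgt
      · exact Or.inl (h1 ⟨hI, hle⟩)
      · exact Or.inr (h3.1 ⟨hI, by omega⟩)
    · rintro (hw | ht)
      · exact h2 hw
      · exact (h3.2 ht).1

/-- **The far flip of defect triples is a nearest-neighbour involution preserving blocks and the antipodal side**
(`9 ≤ N`, `N` odd).  With bases `p j` (the triples occupy the offsets `≥ N-3`), flipping the first coordinate of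
offset `≤ N-4` along the dominoes from `p j` is, at every site having such a coordinate, an involutive `±1`-move to a
site again having such a coordinate; it preserves every product of per-coordinate sets whose far parts are stable
under the flips, and it preserves having a coordinate on a prescribed residue of the triples. [folklore] -/
theorem tstar_far {N : ℕ} [NeZero N] (hN : 9 ≤ N) (hNo : Odd N) (p : Fin 4 → ZMod N) :
    let π : Fin 4 → ZMod N → ZMod N := fun j u => if Even (u - p j).val then u + 1 else u - 1
    let σ : TorusSite 4 N → TorusSite 4 N := fun y =>
      if (y 0 - p 0).val ≤ N - 4 then Function.update y 0 (π 0 (y 0)) else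
      if (y 1 - p 1).val ≤ N - 4 then Function.update y 1 (π 1 (y 1)) else
      if (y 2 - p 2).val ≤ N - 4 then Function.update y 2 (π 2 (y 2)) else
      if (y 3 - p 3).val ≤ N - 4 then Function.update y 3 (π 3 (y 3)) else y
    ∀ y : TorusSite 4 N, (∃ j, (y j - p j).val ≤ N - 4) →
      σ (σ y) = y ∧ (∃ μ : Fin 4, σ y = y + Pi.single μ 1 ∨ y = σ y + Pi.single μ 1) ∧
      (∃ j, (σ y j - p j).val ≤ N - 4) ∧
      (∀ I : Fin 4 → ZMod N → Prop, (∀ j u, I j u → (u - p j).val ≤ N - 4 → I j (π j u)) →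
        (∀ j, I j (y j)) → ∀ j, I j (σ y j)) ∧
      (∀ q : Fin 4 → ZMod N, (∀ i, N - 3 ≤ (q i - p i).val) → (∃ i, y i = q i) → ∃ i, σ y i = q i) := by
  intro π σ y hy
  obtain ⟨S', hS'⟩ := hNo
  have hπ : ∀ j u, (u - p j).val ≤ N - 4 →
      (π j u - p j).val ≤ N - 4 ∧ π j (π j u) = u ∧ (π j u = u + 1 ∨ u = π j u + 1) := by
    intro j u hu
    have F := flip_window (p j) 0 (N - 4) ⟨0, rfl⟩ ⟨S' - 2, by omega⟩ (by omega) u (Nat.zero_le _) hu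
    exact ⟨F.2.1, F.2.2.1, F.2.2.2.1⟩
  obtain ⟨j, hj, -, hσy, hinv, hnn⟩ :=
    first_coord_flip (fun j u => (u - p j).val ≤ N - 4) π hπ y hy
  have hσy' : σ y = Function.update y j (π j (y j)) := hσy
  have hσj : σ y j = π j (y j) := by rw [hσy', Function.update_self]
  have hσi : ∀ i, i ≠ j → σ y i = y i := fun i hi => by rw [hσy', Function.update_of_ne hi]
  refine ⟨hinv, ⟨j, hnn⟩, ⟨j, by rw [hσj]; exact (hπ j _ hj).1⟩, fun I hI hyI i => ?_, fun q hq ⟨i, hi⟩ => ?_⟩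
  · by_cases hi : i = j
    · subst hi; rw [hσj]; exact hI i _ (hyI i) hj
    · rw [hσi i hi]; exact hyI i
  · refine ⟨i, ?_⟩
    have hij : i ≠ j := by
      rintro rfl
      rw [hi] at hj
      have := hq i
      omega
    rw [hσi i hij, hi]

/-- **Registered helper `stub_placementSides_aux7` of crux stmt-QuantumFields-17375** (line `pad-the-fibre`, stub
`stub_placementSides`): the far flip of defect triples moves every far site to a nearest neighbour. [folklore] -/
theorem stub_placementSides_aux7 : ∀ (N : ℕ) [NeZero N], 9 ≤ N → Odd N → ∀ (p : Fin 4 → ZMod N) (y : TorusSite 4 N), (∃ j, (y j - p j).val ≤ N - 4) → ∃ μ : Fin 4, (if (y 0 - p 0).val ≤ N - 4 then Function.update y 0 (if Even (y 0 - p 0).val then y 0 + 1 else y 0 - 1) else if (y 1 - p 1).val ≤ N - 4 then Function.update y 1 (if Even (y 1 - p 1).val then y 1 + 1 else y 1 - 1) else if (y 2 - p 2).val ≤ N - 4 then Function.update y 2 (if Even (y 2 - p 2).val then y 2 + 1 else y 2 - 1) else if (y 3 - p 3).val ≤ N - 4 then Function.update y 3 (if Even (y 3 - p 3).val then y 3 +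 1 else y 3 - 1) else y) = y + Pi.single μ 1 ∨ y = (if (y 0 - p 0).val ≤ N - 4 then Function.update y 0 (if Even (y 0 - p 0).val then y 0 + 1 else y 0 - 1) else if (y 1 - p 1).val ≤ N - 4 then Function.update y 1 (if Even (y 1 - p 1).val then y 1 + 1 else y 1 - 1) else if (y 2 - p 2).val ≤ N - 4 then Function.update y 2 (if Even (y 2 - p 2).val then y 2 + 1 else y 2 - 1) else if (y 3 - p 3).val ≤ N - 4 then Function.update y 3 (if Even (y 3 - p 3).val then y 3 + 1 else y 3 - 1) else y) + Pi.single μ 1 :=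
  fun _ _ hN hNo p y hy => ((tstar_far hN hNo p) y hy).2.1

end Summit.QuantumFields.QCD.Theorems.PadTheFibreTwoStar

end
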